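import Summits.Schanuel.Schanuel.Theorems.RootDecomp1BFiniteOrderRadical02

/-!
# RootDecomp1BFiniteOrderRadical — lens 4, generation 34 «FINITE-ORDER NESTERENKO STOREY» (X(2) at (π, ρπ) for every ρ of exponential Liouville order 57) — continuation (RootDecomp1BFiniteOrderRadical03): §B the KERNEL `algebraicIndependent_radical_of_logSizeMeasure` (radical descent over a log-size measure at finite Liouville order; `maxHeartbeats 1600000` as in the source)

(lens-4 g34 `FiniteOrderRadical.lean`, sha256 721281aa…4b53, own farm rc 0 · 0 sorry · axioms std; critic VERDICT STATUS L1761 (credit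
B-R21 (d), PORT GO LOW); port by census-1 gen 16 in parts `RootDecomp1BFiniteOrderRadical01`–`05` (+ `06` hypothesis-free when the farm builds the
`_holds` cone) — see the PORT NOTE of part 01; `--supports stmt-Schanuel-24622`; rung 0.)
-/

noncomputable section

open Complex

namespace Summit.Schanuel.Schanuel.Theorems.RootDecomp1BFiniteOrderRadical

section Kernel

open MvPolynomial
open Literature.NumberTheory.Transcendental (mvPolyHeight)
open Literature.NumberTheory.Transcendental.PhilipponMain (one_le_mvPolyHeight)
open Summit.Schanuel.Schanuel.Theorems.RootDecomp1BRadicalDescent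
open Summit.Schanuel.Schanuel.Theorems.RootDecomp1KHyper (mvlen mvlen_nonneg abs_coeff_le_mvlen one_le_mvlen
  exists_int_mul_eq_map mvaeval_int_map exists_ball_eval_ne_zero)
open Summit.Schanuel.Schanuel.Theorems.RootDecomp1KGeneric (LiouvilleOrder)
open Summit.Schanuel.Schanuel.Theorems.RootDecomp1KHyper.HyperCell (natAbs_coeff_sup_le_mvlen)

variable {n : ℕ}

/-- `x^k ≤ exp (k x)` for `x ≥ 0`. -/
private theorem pow_le_exp_mul {x : ℝ} (hx : 0 ≤ x) (k : ℕ) : x ^ k ≤ Real.exp (k * x) := by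
  rw [Real.exp_nat_mul]
  exact pow_le_pow_left₀ hx (by linarith [Real.add_one_le_exp x]) k

/-- `q ≤ exp q` for a natural number `q`. -/
private theorem natCast_le_exp (q : ℕ) : (q : ℝ) ≤ Real.exp q := by linarith [Real.add_one_le_exp (q : ℝ)]

set_option maxHeartbeats 1600000 in
/-- **KERNEL THEOREM (radical descent over a LOG-SIZE measure, FINITE Liouville order).** Let `θ = (θ_1, …, θ_n)`
carry `LogSizeMeasure a b θ` (`a ≥ 1`; e.g. `θ = (q₀, P(q₀), Q(q₀))` with `(a, b) = (4, 24)` by §A), let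
`e^{y₀} = θ_{i₀}`, and let `ρ > 0` have exponential Liouville order `m ≥ 2(a+b)+1` (tree `LiouvilleOrder m ρ`:
`|ρ − p/q| < exp(−q^m)` for reduced `p/q ≠ ρ` with `q` arbitrarily large).  Then `(e^{ρ y₀}, ρ, θ_1, …, θ_n)` is
algebraically independent over `ℚ`.

Proof = the g33 / tree kernel `RootDecomp1BNesterenkoRadical.algebraicIndependent_radical_of_polySizeMeasure` verbatim
(specialise an integer relation at `ρ ≈ p/q`, norm form `N = det M` of `Σ_k C_k T^{pk}` modulo `T^q − θ_{i₀}`, formal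
non-vanishing, eigen factorisation, Lipschitz smallness; steps (1), (2), (4) unchanged), except: step (3) feeds the
LOG-SIZE `deg N + log H(N) ≤ (c_E + δ + 4) q²` (not the length `e^{O(q²)}`) to the measure, giving the POLYNOMIAL
lower bound `exp(−c_M q^{2(a+b)})`, so that a finite-order approximation `exp(−q^m)`, `m > 2(a+b)`, already
clashes (`finiteOrder_clash`). -/
theorem algebraicIndependent_radical_of_logSizeMeasure {a b : ℕ} {θ : Fin n → ℂ}
    (hθ : LogSizeMeasure a b θ) (ha : 1 ≤ a) (i₀ : Fin n) {y₀ : ℂ} (hy : cexp y₀ = θ i₀) {ρ : ℝ} {m : ℕ}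
    (hρ : LiouvilleOrder m ρ) (hm : 2 * (a + b) + 1 ≤ m) (hρ0 : 0 < ρ) :
    AlgebraicIndependent ℚ
      (Fin.cons (cexp ((ρ : ℂ) * y₀)) (Fin.cons (ρ : ℂ) θ) : Fin (n + 2) → ℂ) := by
  classical
  by_contra hdep
  obtain ⟨P, hP0, hPv⟩ := exists_int_relation hdep
  obtain ⟨cμ, hcμ, hMeas⟩ := hθ
  -- degrees and the partial degrees in `U` (coordinate 0) and `Y` (coordinate 1)
  set dP := P.totalDegree with hdP
  set K := P.degreeOf 0 with hKdef
  set J := P.degreeOf 1 with hJdef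
  have hK : ∀ s ∈ P.support, s 0 ≤ K := fun s hs => monomial_le_degreeOf 0 hs
  have hJ : ∀ s ∈ P.support, s 1 ≤ J := fun s hs => monomial_le_degreeOf 1 hs
  -- the C¹ function F, its root ρ and a local Lipschitz constant
  have hFρ : Frel P θ y₀ ρ = 0 := by rw [Frel_eq_aeval]; exact hPv
  obtain ⟨Kl, δ₁, hKl, hδ₁, hLip⟩ := exists_lipschitz_Frel P θ y₀ ρ
  -- the fibre polynomial μ of a monomial s₀ of P (guarantees some `C_k ≠ 0` after specialisation)
  obtain ⟨s₀, hs₀⟩ : ∃ s₀, s₀ ∈ P.support := by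
    obtain ⟨t, ht⟩ := MvPolynomial.ne_zero_iff.mp hP0
    exact ⟨t, mem_support_iff.mpr ht⟩
  set k₀ : ℕ := s₀ 0 with hk₀
  set m₀ : Fin n →₀ ℕ := sX s₀ with hm₀
  obtain ⟨μ, hμ⟩ : ∃ μ : Polynomial ℂ, μ = ∑ s ∈ P.support with (s 0 = k₀ ∧ sX s = m₀),
    Polynomial.C ((P.coeff s : ℤ) : ℂ) * Polynomial.X ^ (s 1) := ⟨_, rfl⟩
  have hμ0 : μ ≠ 0 := by
    intro h
    have hc : μ.coeff (s₀ 1) = ((P.coeff s₀ : ℤ) : ℂ) := by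
      rw [hμ, Polynomial.finsetSum_coeff]
      simp only [Polynomial.coeff_C_mul, Polynomial.coeff_X_pow]
      rw [Finset.sum_eq_single s₀]
      · simp
      · intro s hs hne
        have hs' := (Finset.mem_filter.1 hs).2
        rw [if_neg, mul_zero]
        intro h1
        exact hne (eq_of_parts hs'.1 h1.symm hs'.2)
      · intro h'
        exact absurd (Finset.mem_filter.2 ⟨hs₀, rfl, rfl⟩) h'
    rw [h, Polynomial.coeff_zero] at hc
    exact (Int.cast_ne_zero.2 (mem_support_iff.1 hs₀)) hc.symm
  obtain ⟨δ₀, hδ₀, hμball⟩ := exists_ball_eval_ne_zero μ hμ0 ρ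
  have hμeval : ∀ x : ℂ, μ.eval x = ∑ s ∈ P.support with (s 0 = k₀ ∧ sX s = m₀),
      ((P.coeff s : ℤ) : ℂ) * x ^ (s 1) := by
    intro x
    simp only [hμ, Polynomial.eval_finsetSum, Polynomial.eval_mul, Polynomial.eval_C,
      Polynomial.eval_pow, Polynomial.eval_X]
  -- q-independent sizes
  set Θ : ℝ := 1 + ∑ i, ‖θ i‖ with hΘ
  have hsum0 : 0 ≤ ∑ i, ‖θ i‖ := Finset.sum_nonneg fun i _ => norm_nonneg (θ i)
  have hΘ1 : 1 ≤ Θ := by rw [hΘ]; linarith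
  have hΘ0 : 0 ≤ Θ := by linarith
  have hθΘ : ∀ i, ‖θ i‖ ≤ Θ := fun i => by
    have := Finset.single_le_sum (fun j (_ : j ∈ Finset.univ) => norm_nonneg (θ j)) (Finset.mem_univ i)
    rw [hΘ]; linarith
  set Bρ : ℕ := ⌈ρ⌉₊ + 1 with hBρ
  have hBρ1 : ρ + 1 ≤ Bρ := by rw [hBρ]; push_cast; linarith [Nat.le_ceil ρ]
  set δe : ℕ := dP + Bρ * K with hδe
  set LP : ℤ := mvlen P with hLP
  have hLP1 : 1 ≤ LP := one_le_mvlen hP0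
  have hLP1r : (1 : ℝ) ≤ LP := by exact_mod_cast hLP1
  -- constants (g34: the measure enters through `cT`, `cM` and the exponent `G = 2(a+b)`; the clash is polynomial)
  set cE : ℝ := ((K : ℝ) + 1) + LP + J * ((Bρ : ℝ) + 1) with hcE
  have hcE0 : 0 ≤ cE := by positivity
  set cT : ℝ := cE + δe + 4 with hcT
  set G : ℕ := 2 * (a + b) with hGdef
  have hG2 : 2 ≤ G := by omega
  have hGm : G + 1 ≤ m := by omega
  set cM : ℝ := cμ * cT ^ (a + b) with hcM
  have hcM0 : 0 ≤ cM := by positivity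
  set cU : ℝ := ((J : ℝ) + 2) + cE + Θ * ((δe : ℝ) + 1) with hcU
  have hcU0 : 0 ≤ cU := by positivity
  set c₃ : ℝ := (Kl + 1) + cU + cM with hc₃
  have hc₃0 : 0 ≤ c₃ := by positivity
  -- thresholds and the approximation r = p/q
  set δs : ℝ := min (min δ₀ δ₁) (min ρ 1) with hδs
  have hδs0 : 0 < δs := lt_min (lt_min hδ₀ hδ₁) (lt_min hρ0 one_pos)
  obtain ⟨Q₁, hQ₁⟩ := exists_nat_gt c₃
  obtain ⟨Q₂, hQ₂⟩ := exists_nat_gt (-Real.log δs)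
  obtain ⟨r, hrQ, hrne, hrlt⟩ := hρ (max (max Q₁ Q₂) (K + 2))
  set q : ℕ := r.den with hqdef
  have hqK2 : K + 2 ≤ q := (le_max_right _ _).trans hrQ
  have hqQ₁ : Q₁ ≤ q := ((le_max_left _ _).trans (le_max_left _ _)).trans hrQ
  have hqQ₂ : Q₂ ≤ q := ((le_max_right _ _).trans (le_max_left _ _)).trans hrQ
  have hq : 0 < q := by omega
  have hKq : K < q := by omega
  have hq1r : (1 : ℝ) ≤ q := by exact_mod_cast hq
  have hq0r : (0 : ℝ) < q := by positivity
  have hqsq : (q : ℝ) ≤ (q : ℝ) ^ 2 := by nlinarith only [hq1r]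
  have hq2 : (1 : ℝ) ≤ (q : ℝ) ^ 2 := hq1r.trans hqsq
  -- |ρ − r| < δs
  have hq_c₃ : c₃ < q := hQ₁.trans_le (by exact_mod_cast hqQ₁)
  have hsmall : Real.exp (-((q : ℝ) ^ m)) < δs := by
    have h1 : (q : ℝ) ≤ (q : ℝ) ^ m := le_self_pow₀ hq1r (by omega)
    have h3 : (Q₂ : ℝ) ≤ q := by exact_mod_cast hqQ₂
    rw [← Real.exp_log hδs0, Real.exp_lt_exp]
    linarith
  have hρr : |ρ - r| < δs := hrlt.trans hsmall
  have hρr₀ : |(r : ℝ) - ρ| < δ₀ := by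
    rw [abs_sub_comm]; exact hρr.trans_le ((min_le_left _ _).trans (min_le_left _ _))
  have hρr₁ : |(r : ℝ) - ρ| < δ₁ := by
    rw [abs_sub_comm]; exact hρr.trans_le ((min_le_left _ _).trans (min_le_right _ _))
  have hρrρ : |ρ - r| < ρ := hρr.trans_le ((min_le_right _ _).trans (min_le_left _ _))
  have hρr1 : |ρ - r| < 1 := hρr.trans_le ((min_le_right _ _).trans (min_le_right _ _))
  have hr0 : (0 : ℝ) < r := by have := abs_lt.1 hρrρ; linarith
  have hr0' : (0 : ℚ) < r := by exact_mod_cast hr0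
  -- p, coprimality, r = p/q
  set p : ℕ := r.num.natAbs with hpdef
  have hpnum : (p : ℤ) = r.num := Int.natAbs_of_nonneg (Rat.num_pos.2 hr0').le
  have hpq : Nat.Coprime p q := r.reduced
  have hr_eq : (r : ℝ) = (p : ℝ) / q := by
    rw [Rat.cast_def, hqdef]
    congr 1
    rw [← hpnum]; push_cast; rfl
  have hr_eqC : ((r : ℚ) : ℂ) = (p : ℂ) / (q : ℂ) := by
    rw [← Complex.ofReal_ratCast, hr_eq]; push_cast; rfl
  have hpB : p ≤ Bρ * q := by
    have h1 : (r : ℝ) < ρ + 1 := by have := abs_lt.1 hρr1; linarith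
    have h2 : (p : ℝ) / q < Bρ := by rw [← hr_eq]; linarith
    have h3 : (p : ℝ) < Bρ * q := by rwa [div_lt_iff₀ hq0r] at h2
    exact_mod_cast h3.le
  -- the radical s = e^{y₀/q}
  obtain ⟨s, hsdef⟩ : ∃ s : ℂ, s = cexp (y₀ / q) := ⟨_, rfl⟩
  have hqC : (q : ℂ) ≠ 0 := by exact_mod_cast hq.ne'
  have hsq : s ^ q = θ i₀ := by
    rw [hsdef, ← Complex.exp_nat_mul, mul_div_cancel₀ _ hqC, hy]
  have hsp : s ^ p = cexp (((((p : ℝ) / q : ℝ)) : ℂ) * y₀) := by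
    rw [hsdef, ← Complex.exp_nat_mul]
    congr 1
    push_cast
    field_simp
  have hsΘ : ‖s‖ ≤ Θ := by
    by_contra h
    push Not at h
    have h1 : 1 ≤ ‖s‖ := hΘ1.trans h.le
    have h2 : ‖s‖ ≤ ‖s‖ ^ q := le_self_pow₀ h1 (by omega)
    have h3 : ‖s‖ ^ q = ‖θ i₀‖ := by rw [← norm_pow, hsq]
    linarith [hθΘ i₀]
  -- some C_k is nonzero: C_{k₀} has the coefficient q^J μ(r) ≠ 0 at m₀
  have hC : ∃ k ≤ K, Cf P p q J k ≠ 0 := by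
    refine ⟨k₀, hK s₀ hs₀, fun h0 => ?_⟩
    have hcoef : (Cf P p q J k₀).coeff m₀ =
        ∑ s ∈ P.support with (s 0 = k₀ ∧ sX s = m₀),
          P.coeff s * (p : ℤ) ^ (s 1) * (q : ℤ) ^ (J - s 1) := by
      rw [Cf, coeff_sum]
      simp only [coeff_monomial]
      rw [Finset.sum_filter, Finset.sum_filter]
      refine Finset.sum_congr rfl fun s _ => ?_
      by_cases h1 : s 0 = k₀ <;> by_cases h2 : sX s = m₀ <;> simp [h1, h2]
    have hcast : (((Cf P p q J k₀).coeff m₀ : ℤ) : ℂ) = (q : ℂ) ^ J * μ.eval ((r : ℝ) : ℂ) := by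
      rw [hcoef, hμeval, Finset.mul_sum]
      push_cast
      refine Finset.sum_congr rfl fun s hs => ?_
      have hs1 : s 1 ≤ J := hJ s (Finset.mem_filter.1 hs).1
      rw [hr_eqC, ← pow_sub_mul_pow (q : ℂ) hs1, div_pow]
      field_simp
    have hμr : μ.eval ((r : ℝ) : ℂ) ≠ 0 := hμball r (fun h => hrne (by exact_mod_cast h.symm)) hρr₀
    have : (((Cf P p q J k₀).coeff m₀ : ℤ) : ℂ) = 0 := by rw [h0, coeff_zero, Int.cast_zero]
    rw [hcast] at this
    exact (mul_ne_zero (pow_ne_zero _ hqC) hμr) this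
  -- the norm form N = det M ≠ 0 and its evaluation
  obtain ⟨M, hMdef⟩ : ∃ M : Matrix (Fin q) (Fin q) (MvPolynomial (Fin n) ℤ),
      M = radMat (Cf P p q J) K p hq i₀ := ⟨_, rfl⟩
  obtain ⟨N, hNdef⟩ : ∃ N : MvPolynomial (Fin n) ℤ, N = M.det := ⟨_, rfl⟩
  have hN0 : N ≠ 0 := by
    rw [hNdef, hMdef]; exact det_radMat_ne_zero i₀ q (Cf P p q J) hq hKq hpq hC
  obtain ⟨f, hfdef⟩ : ∃ f : MvPolynomial (Fin n) ℤ →+* ℂ, f = (MvPolynomial.aeval θ).toRingHom :=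
    ⟨_, rfl⟩
  have hf : ∀ Q : MvPolynomial (Fin n) ℤ, f Q = aeval θ Q := fun Q => by rw [hfdef]; rfl
  obtain ⟨Mθ, hMθ⟩ : ∃ Mθ : Matrix (Fin q) (Fin q) ℂ, Mθ = f.mapMatrix M := ⟨_, rfl⟩
  have hMθ_apply : ∀ l a', Mθ l a' = aeval θ (M l a') := fun l a' => by
    rw [hMθ, RingHom.mapMatrix_apply, Matrix.map_apply, hf]
  have hdet : Mθ.det = aeval θ N := by rw [hMθ, ← RingHom.map_det, hf, hNdef]
  have hadj : ∀ a' : Fin q, Mθ.adjugate ⟨0, hq⟩ a' = aeval θ (M.adjugate ⟨0, hq⟩ a') := by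
    intro a'
    rw [hMθ, ← RingHom.map_adjugate, RingHom.mapMatrix_apply, Matrix.map_apply, hf]
  -- entry bounds
  obtain ⟨E, hEdef⟩ : ∃ E : ℤ, E = ((K : ℤ) + 1) * (LP * ((p : ℤ) + q) ^ J) := ⟨_, rfl⟩
  have hE1 : 1 ≤ E := by
    have h1 : (1 : ℤ) ≤ (K : ℤ) + 1 := by linarith [Int.natCast_nonneg K]
    have h2 : (1 : ℤ) ≤ ((p : ℤ) + q) ^ J :=
      one_le_pow₀ (by linarith [Int.natCast_nonneg p, show (1:ℤ) ≤ q by exact_mod_cast hq])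
    rw [hEdef]
    calc (1 : ℤ) = 1 * (1 * 1) := by ring
      _ ≤ ((K : ℤ) + 1) * (LP * ((p : ℤ) + q) ^ J) :=
          mul_le_mul h1 (mul_le_mul hLP1 h2 zero_le_one (by linarith)) (by norm_num) (by linarith)
  have hentry : ∀ l a', mvlen (M l a') ≤ E := fun l a' => by
    rw [hMdef, hEdef]
    exact mvlen_radMat_le P p q J hq i₀ (fun k => mvlen_Cf_le P p q J hJ k)
      (mul_nonneg (mvlen_nonneg P) (pow_nonneg (by positivity) _)) l a'
  have hentry' : ∀ l a', (M l a').totalDegree ≤ δe := fun l a' => by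
    rw [hMdef]
    exact totalDegree_radMat_le P p q J hq i₀ hpB l a'
  have hNlen : mvlen N ≤ (q.factorial : ℤ) * E ^ q := by rw [hNdef]; exact mvlen_det_le M hentry
  have hNdeg : N.totalDegree ≤ q * δe := by rw [hNdef]; exact totalDegree_det_le M hentry'
  have hadjB : ∀ a' : Fin q, mvlen (M.adjugate ⟨0, hq⟩ a') ≤ (q.factorial : ℤ) * E ^ q ∧
      (M.adjugate ⟨0, hq⟩ a').totalDegree ≤ q * δe := fun a' => adjugate_bounds M hE1 hentry hentry' _ _
  -- (1) the eigen factorisation  det Mθ = Φθ(s) · Σ_a adj 0 a s^a,  Φθ(s) = q^J F(r)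
  have hfact := det_eq_eigen_mul hq K p (fun k => aeval θ (Cf P p q J k)) (θ i₀) s hsq Mθ (by
    intro l a'
    rw [hMθ_apply, hMdef]
    simp only [radMat, map_sum, map_mul, map_pow, aeval_X])
  have heigen : ∑ k ∈ Finset.range (K + 1), aeval θ (Cf P p q J k) * s ^ (p * k) =
      (q : ℂ) ^ J * Frel P θ y₀ ((p : ℝ) / q) :=
    eigen_eq_Frel P p q J θ y₀ hK hJ hq s hsp
  -- (2) the real-number sizes
  have hEr : (E : ℝ) ≤ Real.exp (((K : ℝ) + 1) + LP + J * (((Bρ : ℝ) + 1) * q)) := by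
    have h1 : (K : ℝ) + 1 ≤ Real.exp ((K : ℝ) + 1) := by linarith [Real.add_one_le_exp ((K:ℝ) + 1)]
    have h2 : (LP : ℝ) ≤ Real.exp (LP : ℝ) := by linarith [Real.add_one_le_exp (LP : ℝ)]
    have h3 : ((p : ℝ) + q) ^ J ≤ Real.exp (J * (((Bρ : ℝ) + 1) * q)) := by
      have hpq' : (p : ℝ) + q ≤ ((Bρ : ℝ) + 1) * q := by
        have : (p : ℝ) ≤ Bρ * q := by exact_mod_cast hpB
        linarith
      exact (pow_le_pow_left₀ (by positivity) hpq' J).trans (pow_le_exp_mul (by positivity) J)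
    have h4 : (0 : ℝ) ≤ (K : ℝ) + 1 := by positivity
    have key : ((K : ℝ) + 1) * ((LP : ℝ) * ((p : ℝ) + q) ^ J) ≤
        Real.exp ((K : ℝ) + 1) * (Real.exp (LP : ℝ) * Real.exp (J * (((Bρ : ℝ) + 1) * q))) :=
      mul_le_mul h1 (mul_le_mul h2 h3 (by positivity) (Real.exp_pos _).le) (by positivity)
        (Real.exp_pos _).le
    have hEcast : (E : ℝ) = ((K : ℝ) + 1) * ((LP : ℝ) * ((p : ℝ) + q) ^ J) := by
      rw [hEdef]; push_cast; ring
    rw [hEcast]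
    calc _ ≤ _ := key
      _ = Real.exp (((K : ℝ) + 1) + LP + J * (((Bρ : ℝ) + 1) * q)) := by
          rw [← Real.exp_add, ← Real.exp_add]; congr 1; ring
  have hE0r : (0 : ℝ) ≤ E := by exact_mod_cast (zero_le_one.trans hE1)
  have hEq : (E : ℝ) ^ q ≤ Real.exp (cE * (q : ℝ) ^ 2) := by
    refine (pow_le_pow_left₀ hE0r hEr q).trans ?_
    rw [← Real.exp_nat_mul, Real.exp_le_exp, hcE]
    have t1 : ((K : ℝ) + 1) * q ≤ ((K : ℝ) + 1) * (q : ℝ) ^ 2 :=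
      mul_le_mul_of_nonneg_left hqsq (by positivity)
    have t2 : (LP : ℝ) * q ≤ (LP : ℝ) * (q : ℝ) ^ 2 := mul_le_mul_of_nonneg_left hqsq (by linarith)
    have t3 : (q : ℝ) * (J * (((Bρ : ℝ) + 1) * q)) = J * ((Bρ : ℝ) + 1) * (q : ℝ) ^ 2 := by ring
    linarith only [t1, t2, t3]
  have hfac : ((q.factorial : ℕ) : ℝ) ≤ Real.exp ((q : ℝ) ^ 2) := by
    have h1 : ((q.factorial : ℕ) : ℝ) ≤ (q : ℝ) ^ q := by exact_mod_cast Nat.factorial_le_pow q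
    refine h1.trans ((pow_le_exp_mul hq0r.le q).trans (le_of_eq ?_))
    rw [sq]
  have hqpow : ∀ k : ℕ, (q : ℝ) ^ k ≤ Real.exp (k * (q : ℝ) ^ 2) := fun k =>
    (pow_le_exp_mul hq0r.le k).trans (by
      rw [Real.exp_le_exp]; exact mul_le_mul_of_nonneg_left hqsq (Nat.cast_nonneg k))
  have hΘpow : ∀ k : ℕ, Θ ^ k ≤ Real.exp (k * Θ) := fun k => pow_le_exp_mul hΘ0 k
  -- (3) lower bound from the LOG-SIZE measure at `t = cT q² ≥ max (deg N + log H(N), e)` (`logSize_lower_bound`)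
  have hlow : Real.exp (-(cM * (q : ℝ) ^ G)) ≤ ‖aeval θ N‖ := by
    have hlenq : ((mvlen N : ℤ) : ℝ) ≤ Real.exp ((q : ℝ) ^ 2) * Real.exp (cE * (q : ℝ) ^ 2) := by
      have : (mvlen N : ℝ) ≤ ((q.factorial : ℕ) : ℝ) * (E : ℝ) ^ q := by exact_mod_cast hNlen
      exact this.trans (mul_le_mul hfac hEq (by positivity) (Real.exp_pos _).le)
    exact logSize_lower_bound hcμ hMeas hN0 hcE0 hcT hGdef hcM hq2 hqsq hlenq (by exact_mod_cast hNdeg)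
  -- (4) upper bound from the factorisation
  have hup : ‖aeval θ N‖ ≤ (Kl + 1) * Real.exp (cU * (q : ℝ) ^ 2) *
      Real.exp (-((q : ℝ) ^ m)) := by
    have hΦ : ‖∑ k ∈ Finset.range (K + 1), aeval θ (Cf P p q J k) * s ^ (p * k)‖ ≤
        (q : ℝ) ^ J * (Kl * |(r : ℝ) - ρ|) := by
      rw [heigen, norm_mul, norm_pow, Complex.norm_natCast]
      refine mul_le_mul_of_nonneg_left ?_ (by positivity)
      have := hLip ((p : ℝ) / q) (by rw [← hr_eq]; exact hρr₁)
      rw [hFρ, sub_zero] at this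
      rw [hr_eq]
      exact this
    have hS : ‖∑ a' : Fin q, Mθ.adjugate ⟨0, hq⟩ a' * s ^ (a' : ℕ)‖ ≤
        (q : ℝ) * ((((q.factorial : ℕ) : ℝ) * (E : ℝ) ^ q) * Θ ^ (q * δe) * Θ ^ q) := by
      refine (norm_sum_le _ _).trans ?_
      have hterm : ∀ a' : Fin q, ‖Mθ.adjugate ⟨0, hq⟩ a' * s ^ (a' : ℕ)‖ ≤
          (((q.factorial : ℕ) : ℝ) * (E : ℝ) ^ q) * Θ ^ (q * δe) * Θ ^ q := by
        intro a'
        rw [norm_mul, norm_pow, hadj]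
        have h1 := norm_mvaeval_le_mvlen (M.adjugate ⟨0, hq⟩ a') θ hΘ1 hθΘ
        have h2 : (mvlen (M.adjugate ⟨0, hq⟩ a') : ℝ) ≤ ((q.factorial : ℕ) : ℝ) * (E : ℝ) ^ q := by
          exact_mod_cast (hadjB a').1
        have h3 : Θ ^ (M.adjugate ⟨0, hq⟩ a').totalDegree ≤ Θ ^ (q * δe) :=
          pow_le_pow_right₀ hΘ1 (hadjB a').2
        have h4 : ‖s‖ ^ (a' : ℕ) ≤ Θ ^ q :=
          (pow_le_pow_left₀ (norm_nonneg _) hsΘ _).trans (pow_le_pow_right₀ hΘ1 a'.isLt.le)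
        have h0 : (0 : ℝ) ≤ (mvlen (M.adjugate ⟨0, hq⟩ a') : ℝ) := by
          exact_mod_cast mvlen_nonneg _
        calc ‖aeval θ (M.adjugate ⟨0, hq⟩ a')‖ * ‖s‖ ^ (a' : ℕ)
            ≤ ((mvlen (M.adjugate ⟨0, hq⟩ a') : ℝ) * Θ ^ (M.adjugate ⟨0, hq⟩ a').totalDegree) * Θ ^ q :=
              mul_le_mul h1 h4 (by positivity) (by positivity)
          _ ≤ (((q.factorial : ℕ) : ℝ) * (E : ℝ) ^ q) * Θ ^ (q * δe) * Θ ^ q := by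
              refine mul_le_mul_of_nonneg_right ?_ (by positivity)
              exact mul_le_mul h2 h3 (by positivity) (by positivity)
      calc ∑ a' : Fin q, ‖Mθ.adjugate ⟨0, hq⟩ a' * s ^ (a' : ℕ)‖
          ≤ ∑ _a' : Fin q, (((q.factorial : ℕ) : ℝ) * (E : ℝ) ^ q) * Θ ^ (q * δe) * Θ ^ q :=
            Finset.sum_le_sum fun a' _ => hterm a'
        _ = (q : ℝ) * ((((q.factorial : ℕ) : ℝ) * (E : ℝ) ^ q) * Θ ^ (q * δe) * Θ ^ q) := by simp
    have hjunk : (q : ℝ) ^ J * ((q : ℝ) * ((((q.factorial : ℕ) : ℝ) * (E : ℝ) ^ q) *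
        Θ ^ (q * δe) * Θ ^ q)) ≤ Real.exp (cU * (q : ℝ) ^ 2) := by
      have h1 := hqpow J
      have h2 : (q : ℝ) ≤ Real.exp ((q : ℝ) ^ 2) :=
        (natCast_le_exp q).trans (Real.exp_le_exp.2 hqsq)
      have h3 := hfac
      have h4 := hEq
      have h5 : Θ ^ (q * δe) * Θ ^ q ≤ Real.exp (Θ * (((δe : ℝ) + 1)) * (q : ℝ) ^ 2) := by
        rw [← pow_add]
        refine (hΘpow _).trans ?_
        rw [Real.exp_le_exp]
        push_cast
        calc ((q : ℝ) * δe + q) * Θ = ((δe : ℝ) + 1) * Θ * q := by ring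
          _ ≤ ((δe : ℝ) + 1) * Θ * (q : ℝ) ^ 2 := mul_le_mul_of_nonneg_left hqsq (by positivity)
          _ = Θ * ((δe : ℝ) + 1) * (q : ℝ) ^ 2 := by ring
      calc (q : ℝ) ^ J * ((q : ℝ) * ((((q.factorial : ℕ) : ℝ) * (E : ℝ) ^ q) * Θ ^ (q * δe) * Θ ^ q))
          = (q : ℝ) ^ J * (q : ℝ) * ((q.factorial : ℕ) : ℝ) * (E : ℝ) ^ q * (Θ ^ (q * δe) * Θ ^ q) := by
            ring
        _ ≤ Real.exp (J * (q : ℝ) ^ 2) * Real.exp ((q : ℝ) ^ 2) * Real.exp ((q : ℝ) ^ 2) *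
            Real.exp (cE * (q : ℝ) ^ 2) * Real.exp (Θ * ((δe : ℝ) + 1) * (q : ℝ) ^ 2) := by
            gcongr
        _ = Real.exp (cU * (q : ℝ) ^ 2) := by
            simp only [← Real.exp_add]; congr 1; rw [hcU]; ring
    have habs : |(r : ℝ) - ρ| ≤ Real.exp (-((q : ℝ) ^ m)) := by
      rw [abs_sub_comm]; exact hrlt.le
    calc ‖aeval θ N‖ = ‖Mθ.det‖ := by rw [hdet]
      _ = ‖∑ k ∈ Finset.range (K + 1), aeval θ (Cf P p q J k) * s ^ (p * k)‖ *
            ‖∑ a' : Fin q, Mθ.adjugate ⟨0, hq⟩ a' * s ^ (a' : ℕ)‖ := by rw [hfact, norm_mul]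
      _ ≤ ((q : ℝ) ^ J * (Kl * |(r : ℝ) - ρ|)) *
            ((q : ℝ) * ((((q.factorial : ℕ) : ℝ) * (E : ℝ) ^ q) * Θ ^ (q * δe) * Θ ^ q)) :=
          mul_le_mul hΦ hS (by positivity) (by positivity)
      _ = Kl * ((q : ℝ) ^ J * ((q : ℝ) * ((((q.factorial : ℕ) : ℝ) * (E : ℝ) ^ q) *
            Θ ^ (q * δe) * Θ ^ q))) * |(r : ℝ) - ρ| := by ring
      _ ≤ (Kl + 1) * Real.exp (cU * (q : ℝ) ^ 2) * Real.exp (-((q : ℝ) ^ m)) := by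
          refine mul_le_mul (mul_le_mul (by linarith) hjunk (by positivity) (by positivity)) habs
            (abs_nonneg _) (by positivity)
  -- (5) the POLYNOMIAL clash `(Kl+1) e^{cU q²} e^{−q^m} < e^{−cM q^G}` (`q > c₃`, `m ≥ G + 1`)
  exact absurd (hlow.trans hup) (not_le.2 (finiteOrder_clash hKl hcU0 hcM0 hc₃ hG2 hGm hq1r hq_c₃))

end Kernel

end Summit.Schanuel.Schanuel.Theorems.RootDecomp1BFiniteOrderRadical

end
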